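import Summits.CriticalPhenomena.PercolationContinuityZ3.Theorems.SahiMasterFamilyPhiVertex
import Summits.CriticalPhenomena.PercolationContinuityZ3.Theorems.SahiMasterFamilyPhiOrbit

/-!
# `F(n)` on the segments from the vertices to the all-ones point, every order: `Φ_n(1_𝒰 + w·1_{𝒰ᶜ}) ≥ 0`
# for every union-closed family `𝒰` and every `w ∈ [0,1]` (no top condition), via the ABSORBED SLOT with value `w`

Unit `prim-masterthm-p4` (gen 14; crux anchor stmt-CriticalPhenomena-4575, helper work; memo
`run/shared/lean/prim/prim-masterthm/prim-masterthm-p4/P4-GEN14-REPORT.md` §4).  Companion of `…PhiVertex` ((V), the case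
`w = 0`), `…PhiScale` (scaling) and `…PrincipalCapStep` (abstract step, absorption factor).

**THEOREM (every order)** `phiSet_segment_nonneg`: for every `n`, every family `𝒰` of subsets of `Fin (n+1)` closed under unions
(NOT required to contain `univ`) and every `w ∈ [0,1]`, the set function `c = 1 on 𝒰, w off 𝒰` has `Φ_{n+1}(c) ≥ 0`; and so do all
its honest sub-functionals (`phiSet_segment_map_nonneg`: restrictions of `c` are of the same kind).  When `univ ∈ 𝒰` the point `c` is a
feasible point of `PhiNonneg (n+1)` (values in `[0,1]`, `c univ = 1`, supermultiplicative: if `S ∪ T ∉ 𝒰` then `S ∉ 𝒰` or `T ∉ 𝒰`), on the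
segment joining the vertex `1_𝒰` (`w = 0`, theorem (V)) to the all-ones point (`w = 1`, `Φ = 0`): **`F(n+1)` holds on all these
segments, every order** — the two-level chains `𝒰 ⊆ 2^{[n+1]}`.

PROOF.  Strong induction on `n`.  If `univ ∈ 𝒰` the top value is `1` and gen 13's abstract step `phiSet_nonneg_of_subfamilies`
reduces to the honest sub-functionals avoiding the last index, which are segment points one order down.  If `univ ∉ 𝒰`, some index
`t⋆` lies in NO member of `𝒰` (else `univ = ⋃ 𝒰 ∈ 𝒰`), so `c_B = w` for every `B ∋ t⋆`: after relabelling `t⋆ ↦ last`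
(`PhiCert.phiSet_actV`), the **absorbed-slot lemma** `phiSet_nonneg_of_last_eq_const` applies — if `β ≤ 1` and `β_B = w ≥ 0` for
every `B ∋ last` then `Φ_{k+1}(β) = w · Σ_{σ ∈ S_k} ∏_{c ∈ cyc σ} (1 − β_c) ≥ 0` (the `w = 1` case is gen 13's
`phiSet_nonneg_of_last_eq_one`; same comparison family `snoc (realF∘castSucc) (∏ realF)` in the signed model `realW β`, Lieb–Sahi's
block expansion along the last index [LiebSahi2021, Prop. 3.4], the join–absorption factorisation `sahiE_snoc_eq_of_absorbing` and
`absorbFactor_one_nonneg_of_moments`).  HONEST FRAMING: structural (an explicit infinite family of feasible points of `F(n)` for every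
`n`); `PhiNonneg n` (n ≥ 8), Sahi's `C_k`, Kahn's Conjecture 5 and the master theorem remain OPEN.  Axioms standard. [this work]
-/

noncomputable section

open scoped Classical

namespace Summit.CriticalPhenomena.PercolationContinuityZ3.Theorems

namespace PhiSegment

open Finset Function
open Literature.Combinatorics.Sahi2008
open Literature.Combinatorics.Sahi2008.CycleForm
open PrincipalCapBeta (phiSet realF realW)
open PrincipalCapStep (fTop_mul_realF ex_fTop prod_gFam_eq_fTop coRest_gFam_eq ex_prod_realF_castSucc
  absorbFactor_one_nonneg_of_moments)

variable {k : ℕ}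

/-! ### The absorbed slot with value `w` -/

/-- **Absorbed slot.**  If `β ≤ 1`, `0 ≤ w` and `β_B = w` for every `B` containing the last index, then `Φ_{k+1}(β) ≥ 0`; indeed
`Φ_{k+1}(β) = w·Σ_{σ ∈ S_k} ∏_{c ∈ cyc σ} (1 − β_c)`, `w` times the absorption factor of the comparison family (gen 13's
`phiSet_nonneg_of_last_eq_one` is `w = 1`). [this work] -/
theorem phiSet_nonneg_of_last_eq_const (β : Finset (Fin (k + 1)) → ℝ) (h1 : ∀ B, β B ≤ 1) {w : ℝ} (hw0 : 0 ≤ w)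
    (hw : ∀ B, Fin.last k ∈ B → β B = w) : 0 ≤ phiSet (k + 1) β := by
  set μ := realW β with hμ
  have hk : 1 ≤ k + 1 := Nat.succ_le_succ (Nat.zero_le k)
  have huniv : β univ = w := hw univ (mem_univ _)
  have hG : 0 ≤ sahiE μ (k + 1) (Fin.snoc (fun j : Fin k => realF j.castSucc) (∏ i : Fin (k + 1), realF i) :
      Fin (k + 1) → Finset (Fin (k + 1)) → ℝ) := by
    have e1 : sahiE μ (k + 1) (Fin.snoc (fun j : Fin k => realF j.castSucc) (∏ i : Fin (k + 1), realF i) :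
        Fin (k + 1) → Finset (Fin (k + 1)) → ℝ) =
        SahiJoinAbsorption.absorbFactor μ 1 k (fun j : Fin k => realF j.castSucc) * ex μ (∏ i : Fin (k + 1), realF i) :=
      SahiJoinAbsorption.sahiE_snoc_eq_of_absorbing μ (fun j : Fin k => realF j.castSucc) (∏ i : Fin (k + 1), realF i)
        fTop_mul_realF
    rw [e1, ex_fTop, huniv]
    refine mul_nonneg (absorbFactor_one_nonneg_of_moments μ k (fun j : Fin k => realF j.castSucc) fun S _ => ?_) hw0
    rw [ex_prod_realF_castSucc]
    exact h1 _
  have eF := sahiE_eq_sum_blocks μ hk realF (Fin.last k)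
  have eG := sahiE_eq_sum_blocks μ hk (Fin.snoc (fun j : Fin k => realF j.castSucc) (∏ i : Fin (k + 1), realF i) :
    Fin (k + 1) → Finset (Fin (k + 1)) → ℝ) (Fin.last k)
  rw [PrincipalCapBeta.phiSet_eq_sahiE_real, eF]
  rw [eG] at hG
  refine le_trans hG (le_of_eq (sum_congr rfl fun B hB => ?_))
  have hlast : Fin.last k ∈ B := (mem_filter.1 hB).2
  have mF : ex μ (fun x => ∏ j ∈ B, realF j x) = β B := by
    have e1 : (fun x => ∏ j ∈ B, realF j x) = ∏ j ∈ B, (realF j : Finset (Fin (k + 1)) → ℝ) :=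
      funext fun x => (Finset.prod_apply x B _).symm
    rw [e1, PrincipalCapBeta.ex_realW_prod]
  have mG : ex μ (fun x => ∏ j ∈ B, (Fin.snoc (fun j : Fin k => realF j.castSucc) (∏ i : Fin (k + 1), realF i) :
      Fin (k + 1) → Finset (Fin (k + 1)) → ℝ) j x) = β univ := by
    have e1 : (fun x => ∏ j ∈ B, (Fin.snoc (fun j : Fin k => realF j.castSucc) (∏ i : Fin (k + 1), realF i) :
        Fin (k + 1) → Finset (Fin (k + 1)) → ℝ) j x) =
        ∏ j ∈ B, (Fin.snoc (fun j : Fin k => realF j.castSucc) (∏ i : Fin (k + 1), realF i) :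
          Fin (k + 1) → Finset (Fin (k + 1)) → ℝ) j :=
      funext fun x => (Finset.prod_apply x B _).symm
    rw [e1, prod_gFam_eq_fTop hlast, ex_fTop]
  rw [mF, mG, coRest_gFam_eq μ hlast, hw B hlast, huniv]

/-! ### Union-closed families: an index missed by every member -/

variable {n : ℕ}

/-- In a union-closed family the union of a nonempty subfamily is a member. [folklore] -/
theorem biUnion_mem_of_unionClosed {𝒰 : Finset (Finset (Fin n))} (hU : ∀ A ∈ 𝒰, ∀ B ∈ 𝒰, A ∪ B ∈ 𝒰) :
    ∀ R : Finset (Finset (Fin n)), R ⊆ 𝒰 → R.Nonempty → R.biUnion id ∈ 𝒰 := by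
  intro R
  induction R using Finset.induction_on with
  | empty => intro _ h; exact absurd h (by simp)
  | insert A R hA ihR =>
    intro hR _
    rcases R.eq_empty_or_nonempty with hRe | hRne
    · rw [hRe, insert_empty, singleton_biUnion, id]
      exact hR (mem_insert_self _ _)
    · rw [biUnion_insert, id]
      exact hU _ (hR (mem_insert_self _ _)) _ (ihR ((subset_insert _ _).trans hR) hRne)

/-- If a union-closed family of subsets of `Fin (n+1)` does not contain `univ`, some index lies in none of its members.
[this work] -/
theorem exists_forall_notMem (𝒰 : Finset (Finset (Fin (n + 1)))) (hU : ∀ A ∈ 𝒰, ∀ B ∈ 𝒰, A ∪ B ∈ 𝒰)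
    (htop : univ ∉ 𝒰) : ∃ t : Fin (n + 1), ∀ S ∈ 𝒰, t ∉ S := by
  by_contra h
  push Not at h
  have hcov : ∀ t : Fin (n + 1), ∃ S ∈ 𝒰, t ∈ S := h
  have hne : 𝒰.Nonempty := by
    obtain ⟨S, hS, _⟩ := hcov 0
    exact ⟨S, hS⟩
  have hmem := biUnion_mem_of_unionClosed hU 𝒰 Subset.rfl hne
  have heq : 𝒰.biUnion id = univ := by
    ext t
    simp only [mem_biUnion, id, mem_univ, iff_true]
    obtain ⟨S, hS, ht⟩ := hcov t
    exact ⟨S, hS, ht⟩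
  rw [heq] at hmem
  exact htop hmem

/-! ### Restrictions of segment points are segment points -/

/-- Pulling `𝒰` back along an embedding keeps it closed under unions. [this work] -/
theorem unionClosed_comap {m : ℕ} (𝒰 : Finset (Finset (Fin n))) (hU : ∀ A ∈ 𝒰, ∀ B ∈ 𝒰, A ∪ B ∈ 𝒰) (e : Fin m ↪ Fin n) :
    ∀ A ∈ (univ : Finset (Finset (Fin m))).filter (fun S => S.map e ∈ 𝒰),
      ∀ B ∈ (univ : Finset (Finset (Fin m))).filter (fun S => S.map e ∈ 𝒰),
        A ∪ B ∈ (univ : Finset (Finset (Fin m))).filter (fun S => S.map e ∈ 𝒰) := by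
  intro A hA B hB
  rw [mem_filter] at hA hB ⊢
  refine ⟨mem_univ _, ?_⟩
  rw [Finset.map_union]
  exact hU _ hA.2 _ hB.2

/-- The restriction of the segment point of `𝒰` along `e` is the segment point of the pulled-back family. [this work] -/
theorem segment_comap {m : ℕ} (𝒰 : Finset (Finset (Fin n))) (e : Fin m ↪ Fin n) (w : ℝ) :
    (fun S : Finset (Fin m) => if S.map e ∈ 𝒰 then (1 : ℝ) else w) =
      fun S => if S ∈ (univ : Finset (Finset (Fin m))).filter (fun S => S.map e ∈ 𝒰) then (1 : ℝ) else w := by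
  funext S
  simp only [mem_filter, mem_univ, true_and]

/-! ### The theorem -/

/-- **`Φ_{n+1}(1_𝒰 + w·1_{𝒰ᶜ}) ≥ 0` for every union-closed `𝒰` (no top condition) and every `w ∈ [0,1]`, every order.**
[this work] -/
theorem phiSet_segment_nonneg : ∀ (n : ℕ) (𝒰 : Finset (Finset (Fin (n + 1)))), (∀ A ∈ 𝒰, ∀ B ∈ 𝒰, A ∪ B ∈ 𝒰) →
    ∀ {w : ℝ}, 0 ≤ w → w ≤ 1 → 0 ≤ phiSet (n + 1) (fun S => if S ∈ 𝒰 then (1 : ℝ) else w) := by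
  intro n
  induction n using Nat.strong_induction_on with
  | _ n ih =>
  intro 𝒰 hU w hw0 hw1
  have h1 : ∀ B : Finset (Fin (n + 1)), (if B ∈ 𝒰 then (1 : ℝ) else w) ≤ 1 := fun B => by
    split_ifs
    · exact le_rfl
    · exact hw1
  by_cases htop : univ ∈ 𝒰
  · -- top value 1: the abstract step, sub-functionals are segment points one order down
    refine PrincipalCapStep.phiSet_nonneg_of_subfamilies _ h1 (if_pos htop) fun m e he => ?_
    show 0 ≤ phiSet (m + 1) (fun S : Finset (Fin (m + 1)) => if S.map e ∈ 𝒰 then (1 : ℝ) else w)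
    rw [segment_comap 𝒰 e w]
    exact ih m (PhiVertex.lt_of_emb_ne_last e he) _ (unionClosed_comap 𝒰 hU e) hw0 hw1
  · -- top value w: an index missed by every member is an absorbed slot after relabelling
    obtain ⟨t, ht⟩ := exists_forall_notMem 𝒰 hU htop
    let σ : Equiv.Perm (Fin (n + 1)) := Equiv.swap t (Fin.last n)
    rw [← PhiCert.phiSet_actV σ]
    refine phiSet_nonneg_of_last_eq_const _ (fun B => ?_) hw0 fun B hB => ?_
    · unfold PhiCert.actV; exact h1 _
    · unfold PhiCert.actV
      have hmem : t ∈ B.map σ.toEmbedding := by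
        rw [mem_map]
        exact ⟨Fin.last n, hB, by simp [σ]⟩
      show (if B.map σ.toEmbedding ∈ 𝒰 then (1 : ℝ) else w) = w
      rw [if_neg fun h => ht _ h hmem]

/-- **Hereditary form**: every honest sub-functional of a segment point is `≥ 0` (restrictions along embeddings
`Fin (m+1) ↪ Fin (n+1)` are again segment points). [this work] -/
theorem phiSet_segment_map_nonneg (𝒰 : Finset (Finset (Fin (n + 1)))) (hU : ∀ A ∈ 𝒰, ∀ B ∈ 𝒰, A ∪ B ∈ 𝒰)
    {w : ℝ} (hw0 : 0 ≤ w) (hw1 : w ≤ 1) (m : ℕ) (e : Fin (m + 1) ↪ Fin (n + 1)) :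
    0 ≤ phiSet (m + 1) (fun S : Finset (Fin (m + 1)) => if S.map e ∈ 𝒰 then (1 : ℝ) else w) := by
  rw [segment_comap 𝒰 e w]
  exact phiSet_segment_nonneg m _ (unionClosed_comap 𝒰 hU e) hw0 hw1

/-- **`F(n+1)` on the segments.**  For `univ ∈ 𝒰` the segment point is a feasible point of `PhiNonneg (n+1)`: values in `[0,1]`,
top value `1`, supermultiplicative. [this work] -/
theorem segment_feasible (𝒰 : Finset (Finset (Fin (n + 1)))) (hU : ∀ A ∈ 𝒰, ∀ B ∈ 𝒰, A ∪ B ∈ 𝒰) (htop : univ ∈ 𝒰)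
    {w : ℝ} (hw0 : 0 ≤ w) (hw1 : w ≤ 1) :
    (∀ B, 0 ≤ (fun S : Finset (Fin (n + 1)) => if S ∈ 𝒰 then (1 : ℝ) else w) B) ∧
      (∀ B, (fun S : Finset (Fin (n + 1)) => if S ∈ 𝒰 then (1 : ℝ) else w) B ≤ 1) ∧
      (fun S : Finset (Fin (n + 1)) => if S ∈ 𝒰 then (1 : ℝ) else w) univ = 1 ∧
      (∀ S T, (fun S : Finset (Fin (n + 1)) => if S ∈ 𝒰 then (1 : ℝ) else w) S *
          (fun S : Finset (Fin (n + 1)) => if S ∈ 𝒰 then (1 : ℝ) else w) T ≤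
        (fun S : Finset (Fin (n + 1)) => if S ∈ 𝒰 then (1 : ℝ) else w) (S ∪ T)) := by
  refine ⟨fun B => ?_, fun B => ?_, if_pos htop, fun S T => ?_⟩
  · show 0 ≤ (if B ∈ 𝒰 then (1 : ℝ) else w); split_ifs <;> [norm_num; exact hw0]
  · show (if B ∈ 𝒰 then (1 : ℝ) else w) ≤ 1; split_ifs <;> [norm_num; exact hw1]
  · show (if S ∈ 𝒰 then (1 : ℝ) else w) * (if T ∈ 𝒰 then (1 : ℝ) else w) ≤ (if S ∪ T ∈ 𝒰 then (1 : ℝ) else w)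
    by_cases hST : S ∪ T ∈ 𝒰
    · rw [if_pos hST]
      have a1 : (if S ∈ 𝒰 then (1 : ℝ) else w) ≤ 1 := by split_ifs <;> [norm_num; exact hw1]
      have b1 : (if T ∈ 𝒰 then (1 : ℝ) else w) ≤ 1 := by split_ifs <;> [norm_num; exact hw1]
      have b0 : 0 ≤ (if T ∈ 𝒰 then (1 : ℝ) else w) := by split_ifs <;> [norm_num; exact hw0]
      nlinarith
    · rw [if_neg hST]
      -- `S ∪ T ∉ 𝒰` forces `S ∉ 𝒰` or `T ∉ 𝒰`
      by_cases hS : S ∈ 𝒰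
      · have hT : T ∉ 𝒰 := fun hT => hST (hU S hS T hT)
        rw [if_pos hS, if_neg hT, one_mul]
      · rw [if_neg hS]
        have b1 : (if T ∈ 𝒰 then (1 : ℝ) else w) ≤ 1 := by split_ifs <;> [norm_num; exact hw1]
        nlinarith

end PhiSegment

end Summit.CriticalPhenomena.PercolationContinuityZ3.Theorems
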